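import Literature.Geometry.Riemannian.SphericalCylinderEntropyKernelCalculus
import Summits.SmoothPoincare4.SmoothPoincare4.Theorems.CylinderEntropyCylinderRungTwoCylKernelSlabBounds
import Mathlib.Analysis.Calculus.MeanValue
import Mathlib.Analysis.Normed.Module.Convex
import HarnessLib

/-!
# The typed kernel of `N = S⁴ × ℝ` is Lipschitz in the point, uniformly in the centre and in the
# scale `τ ≥ τ₀` (registered helper `helper_cylKernel_lipschitzOn`)

Registered helper `helper_cylKernel_lipschitzOn` (wave 2, lead c7) of line `killing-flux` of the crux
`CylinderEntropy.CylinderRungTwo` (stmt-SmoothPoincare4-7631).  Everything here is proved (no named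
facts, no definitions); theorems only.

The typed slice-normalised backward heat kernel of the round cylinder `N = {z ∈ ℝ⁶ | ∑_{i<5} zᵢ² = 1}`
centred at `p` at scale `τ > 0` is `K_{p,τ}(z) = 𝔥(τ, ⟨z', p'⟩) · e^{-(z₅ - p₅)²/4τ}`
(`SphericalCylinderEntropy.cylKernel`, `cylKernel_eq`), `𝔥(τ, ·) = zonal τ` the Gegenbauer series
of `vol(S⁴)` times the zonal heat kernel of `S⁴`.  The upper semi-continuity of the typed entropy
under `C⁰`-small deformations at scales `τ ≥ τ₀` (the port of the Chodosh–Mantoulidis–Schulze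
perturbation step to `N`) rests on the following analytic fact, proved here:

**for every `τ₀ > 0` there is one constant `L` such that `z ↦ K_{p,τ}(z)` is `L`-Lipschitz on the
solid cylinder `C = {z ∈ ℝ⁶ | ∑_{i<5} zᵢ² ≤ 1} ⊇ N`, for every centre `p` with `|p'| = 1` and every
scale `τ ≥ τ₀`.**

*Proof.* `C` is convex (the preimage of the closed unit ball of `ℝ⁵` under the linear truncation
`truncL`), and `K_{p,τ}` is differentiable everywhere (`hasFDerivAt_cylKernel`), so by the mean value
inequality on convex sets (`Convex.lipschitzOnWith_of_nnnorm_fderiv_le`) it suffices to bound the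
operator norm of `D K_{p,τ}(z)` for `z ∈ C` uniformly.  By `fderiv_cylKernel_apply`,
`D K_{p,τ}(z) v = (𝔥'(s) ⟨v', p'⟩ - 𝔥(s) · x/(2τ) · v₅) e^{-x²/4τ}` with `s = ⟨z', p'⟩`,
`x = z₅ - p₅`.  On `C`, Cauchy–Schwarz gives `|s| ≤ 1`, and on `[τ₀, ∞) × [-1, 1]` the series
majorants of the tree give `|𝔥| ≤ Z₀ := ∑_k e^{-k(k+3)τ₀} 32^k` (`abs_zonal_le_majorant_of_le`) and
`|𝔥'| ≤ Z₁ := ∑_k e^{-k(k+3)τ₀} 128^k` (term-wise derivative `hasDerivAt_zonal_tsum` with the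
majorant `abs_wt_mul_deriv_gegen_le`, monotone in `τ`).  Finally `|⟨v', p'⟩|, |v₅| ≤ ‖v‖`,
`e^{-x²/4τ} ≤ 1` (the coordinate estimates of the landed `CylKernelSlabBounds`), and the elementary `|x|/(2τ) · e^{-x²/4τ} ≤ 1/(4τ₀) + 1`
(`2|x| ≤ 1 + x²` and `y e^{-y} ≤ 1` with `y = x²/4τ`), whence
`‖D K_{p,τ}(z)‖ ≤ L := Z₁ + Z₀ (1/(4τ₀) + 1)`.

References: R. S. Hamilton, *Monotonicity formulas for parabolic flows on manifolds*,
Comm. Anal. Geom. 1 (1993), 127–137, §4 (the kernel); the estimates are elementary calculus.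
-/

-- the prescribed namespace `Summit.SmoothPoincare4.SmoothPoincare4.…` repeats `SmoothPoincare4`
set_option linter.dupNamespace false

noncomputable section

open MeasureTheory Set Function Filter Module
open scoped ContDiff ENNReal Topology NNReal BigOperators

namespace Summit.SmoothPoincare4.SmoothPoincare4.Theorems.CylinderRungTwo.KillingFlux

open Literature.Geometry.Riemannian
open Literature.Geometry.Riemannian.SphericalCylinderEntropy (cylKernel zonal wt gegen truncL
  truncL_apply cylKernel_eq fderiv_cylKernel_apply hasFDerivAt_cylKernel hasDerivAt_zonal_tsum
  abs_wt_mul_deriv_gegen_le exp_weight_antitone summable_exp_mul_pow_of_pos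
  abs_zonal_le_majorant_of_le)
-- the coordinate estimates `|⟨v', p'⟩|, |v₅| ≤ ‖v‖` and `e^{-x²/4τ} ≤ 1` of the landed slab bounds
open Summit.SmoothPoincare4.SmoothPoincare4.Cruxes.CylinderRungTwo.KillingFlux.CylKernelSlabBounds
  (abs_sum_mul_le_norm abs_apply_five_le_norm gaussFactor_le_one)

namespace CylKernelLipschitz

/-! ## Uniform bound of `∂_s 𝔥` on `[τ₀, ∞) × [-1, 1]` -/

/-- **Uniform bound of the `s`-derivative of the typed zonal kernel**: for `τ ≥ τ₀ > 0` and
`|s| ≤ 1`, `|∂_s 𝔥(τ, s)| ≤ ∑_k e^{-k(k+3)τ₀} 128^k` (term-wise derivative and the first-derivative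
majorant of the modes, non-increasing in the scale). [folklore] -/
theorem abs_deriv_zonal_le_of_le {τ₀ τ s : ℝ} (hτ₀ : 0 < τ₀) (hτ : τ₀ ≤ τ) (hs : |s| ≤ 1) :
    |deriv (zonal τ) s| ≤ ∑' k : ℕ, Real.exp (-((k : ℝ) * ((k : ℝ) + 3)) * τ₀) * 128 ^ k := by
  have hτ' : 0 < τ := hτ₀.trans_le hτ
  have hd : deriv (zonal τ) s = ∑' k : ℕ, wt k τ * deriv (gegen k) s :=
    (hasDerivAt_zonal_tsum hτ' s).deriv
  rw [hd]
  have hsum := summable_exp_mul_pow_of_pos hτ₀ (C := 128) (by norm_num)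
  have h := tsum_of_norm_bounded hsum.hasSum (f := fun k : ℕ => wt k τ * deriv (gegen k) s)
    (fun k => by
      rw [Real.norm_eq_abs]
      have h1 := abs_wt_mul_deriv_gegen_le k τ (R := 1) le_rfl hs
      rw [mul_one] at h1
      exact h1.trans (mul_le_mul_of_nonneg_right (exp_weight_antitone k hτ) (by positivity)))
  rwa [Real.norm_eq_abs] at h

/-! ## The first moment of the Gaussian factor -/

/-- **First moment of the Gaussian factor, uniformly in `τ ≥ τ₀`**:
`|x/(2τ)| · e^{-x²/4τ} ≤ 1/(4τ₀) + 1` (`2|x| ≤ 1 + x²`, `e^{-x²/4τ} ≤ 1` and `y e^{-y} ≤ 1` for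
`y = x²/4τ`). [folklore] -/
theorem gaussMoment_le {τ₀ τ : ℝ} (hτ₀ : 0 < τ₀) (hτ : τ₀ ≤ τ) (x : ℝ) :
    |x / (2 * τ)| * Real.exp (-(x ^ 2) / (4 * τ)) ≤ 1 / (4 * τ₀) + 1 := by
  have hτ' : 0 < τ := hτ₀.trans_le hτ
  have hG0 : 0 < Real.exp (-(x ^ 2) / (4 * τ)) := Real.exp_pos _
  have hG1 : Real.exp (-(x ^ 2) / (4 * τ)) ≤ 1 := gaussFactor_le_one hτ' x
  -- `y e^{-y} ≤ 1` with `y = x² / 4τ`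
  have hy : x ^ 2 / (4 * τ) * Real.exp (-(x ^ 2) / (4 * τ)) ≤ 1 := by
    have h := Real.add_one_le_exp (x ^ 2 / (4 * τ))
    have hGe : Real.exp (-(x ^ 2) / (4 * τ)) = (Real.exp (x ^ 2 / (4 * τ)))⁻¹ := by
      rw [← Real.exp_neg, neg_div]
    rw [hGe, mul_inv_le_iff₀ (Real.exp_pos _), one_mul]
    have h0 : (0 : ℝ) ≤ x ^ 2 / (4 * τ) := by positivity
    linarith
  have habs : |x / (2 * τ)| = |x| / (2 * τ) := by
    rw [abs_div, abs_of_pos (by positivity : (0 : ℝ) < 2 * τ)]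
  have h2x : 2 * |x| ≤ 1 + x ^ 2 := by nlinarith [sq_abs x, sq_nonneg (|x| - 1), abs_nonneg x]
  have hstep : |x| / (2 * τ) ≤ (1 + x ^ 2) / (4 * τ) := by
    rw [div_le_div_iff₀ (by positivity) (by positivity)]
    nlinarith
  have h14 : 1 / (4 * τ) ≤ 1 / (4 * τ₀) := one_div_le_one_div_of_le (by positivity) (by linarith)
  rw [habs]
  calc |x| / (2 * τ) * Real.exp (-(x ^ 2) / (4 * τ))
      ≤ (1 + x ^ 2) / (4 * τ) * Real.exp (-(x ^ 2) / (4 * τ)) :=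
        mul_le_mul_of_nonneg_right hstep hG0.le
    _ = 1 / (4 * τ) * Real.exp (-(x ^ 2) / (4 * τ)) +
          x ^ 2 / (4 * τ) * Real.exp (-(x ^ 2) / (4 * τ)) := by ring
    _ ≤ 1 / (4 * τ₀) * 1 + 1 := add_le_add (mul_le_mul h14 hG1 hG0.le (by positivity)) hy
    _ = 1 / (4 * τ₀) + 1 := by ring

/-! ## The solid cylinder -/

/-- On the solid cylinder `∑_{i<5} zᵢ² ≤ 1` the zonal argument satisfies `|⟨z', p'⟩| ≤ 1` for
`|p'| = 1` (Cauchy–Schwarz). [folklore] -/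
theorem abs_sum_mul_le_one_of_le {z p : EuclideanSpace ℝ (Fin 6)}
    (hz : ∑ i : Fin 5, z (Fin.castSucc i) ^ 2 ≤ 1) (hp : ∑ i : Fin 5, p (Fin.castSucc i) ^ 2 = 1) :
    |∑ i : Fin 5, z (Fin.castSucc i) * p (Fin.castSucc i)| ≤ 1 := by
  rw [← sq_le_one_iff_abs_le_one]
  have h := Finset.sum_mul_sq_le_sq_mul_sq Finset.univ
    (fun i : Fin 5 => z (Fin.castSucc i)) (fun i : Fin 5 => p (Fin.castSucc i))
  simp only [hp, mul_one] at h
  exact h.trans hz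

/-- The solid cylinder `{∑_{i<5} zᵢ² ≤ 1}` is the preimage of the closed unit ball of `ℝ⁵` under the
truncation `truncL`. [folklore] -/
theorem solidCyl_eq_preimage :
    {z : EuclideanSpace ℝ (Fin 6) | ∑ i : Fin 5, z (Fin.castSucc i) ^ 2 ≤ 1} =
      ⇑truncL ⁻¹' Metric.closedBall (0 : EuclideanSpace ℝ (Fin 5)) 1 := by
  ext z
  rw [Set.mem_setOf_eq, Set.mem_preimage, mem_closedBall_zero_iff, ← sq_le_one_iff₀ (norm_nonneg _),
    EuclideanSpace.real_norm_sq_eq]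
  simp only [truncL_apply]

/-- **The solid cylinder `{∑_{i<5} zᵢ² ≤ 1} ⊂ ℝ⁶` is convex** (a linear preimage of a ball).
[folklore] -/
theorem convex_solidCyl :
    Convex ℝ {z : EuclideanSpace ℝ (Fin 6) | ∑ i : Fin 5, z (Fin.castSucc i) ^ 2 ≤ 1} := by
  rw [solidCyl_eq_preimage]
  exact (convex_closedBall (0 : EuclideanSpace ℝ (Fin 5)) 1).linear_preimage truncL.toLinearMap

/-! ## The uniform operator-norm bound of the derivative -/

/-- **Uniform bound of `D K_{p,τ}` on the solid cylinder**: for `τ ≥ τ₀ > 0`, `|p'| = 1` and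
`∑_{i<5} zᵢ² ≤ 1`, `‖D K_{p,τ}(z)‖ ≤ Z₁ + Z₀ (1/(4τ₀) + 1)` with the series majorants
`Z₀ = ∑_k e^{-k(k+3)τ₀} 32^k`, `Z₁ = ∑_k e^{-k(k+3)τ₀} 128^k`. [folklore] -/
theorem norm_fderiv_cylKernel_le {τ₀ τ : ℝ} (hτ₀ : 0 < τ₀) (hτ : τ₀ ≤ τ)
    {p z : EuclideanSpace ℝ (Fin 6)} (hp : ∑ i : Fin 5, p (Fin.castSucc i) ^ 2 = 1)
    (hz : ∑ i : Fin 5, z (Fin.castSucc i) ^ 2 ≤ 1) :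
    ‖fderiv ℝ (cylKernel p τ) z‖ ≤
      (∑' k : ℕ, Real.exp (-((k : ℝ) * ((k : ℝ) + 3)) * τ₀) * 128 ^ k) +
        (∑' k : ℕ, Real.exp (-((k : ℝ) * ((k : ℝ) + 3)) * τ₀) * 32 ^ k) * (1 / (4 * τ₀) + 1) := by
  have hτ' : 0 < τ := hτ₀.trans_le hτ
  set Z₀ : ℝ := ∑' k : ℕ, Real.exp (-((k : ℝ) * ((k : ℝ) + 3)) * τ₀) * 32 ^ k with hZ₀def
  set Z₁ : ℝ := ∑' k : ℕ, Real.exp (-((k : ℝ) * ((k : ℝ) + 3)) * τ₀) * 128 ^ k with hZ₁def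
  have hZ₀ : 0 ≤ Z₀ := tsum_nonneg fun k => by positivity
  have hZ₁ : 0 ≤ Z₁ := tsum_nonneg fun k => by positivity
  refine ContinuousLinearMap.opNorm_le_bound _ (by positivity) fun v => ?_
  have hG0 : 0 < Real.exp (-((z 5 - p 5) ^ 2) / (4 * τ)) := Real.exp_pos _
  have hG1 : Real.exp (-((z 5 - p 5) ^ 2) / (4 * τ)) ≤ 1 := gaussFactor_le_one hτ' _
  rw [Real.norm_eq_abs, fderiv_cylKernel_apply p hτ' z v, abs_mul, abs_of_pos hG0]
  have hs : |∑ i : Fin 5, z (Fin.castSucc i) * p (Fin.castSucc i)| ≤ 1 := abs_sum_mul_le_one_of_le hz hp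
  have h0 : |zonal τ (∑ i : Fin 5, z (Fin.castSucc i) * p (Fin.castSucc i))| ≤ Z₀ :=
    abs_zonal_le_majorant_of_le hτ₀ hτ hs
  have h1 : |deriv (zonal τ) (∑ i : Fin 5, z (Fin.castSucc i) * p (Fin.castSucc i))| ≤ Z₁ :=
    abs_deriv_zonal_le_of_le hτ₀ hτ hs
  have hv1 : |∑ i : Fin 5, v (Fin.castSucc i) * p (Fin.castSucc i)| ≤ ‖v‖ := abs_sum_mul_le_norm v hp
  have hv2 : |v 5| ≤ ‖v‖ := abs_apply_five_le_norm v
  have hq : |(z 5 - p 5) / (2 * τ)| * Real.exp (-((z 5 - p 5) ^ 2) / (4 * τ)) ≤ 1 / (4 * τ₀) + 1 :=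
    gaussMoment_le hτ₀ hτ (z 5 - p 5)
  have hA : |deriv (zonal τ) (∑ i : Fin 5, z (Fin.castSucc i) * p (Fin.castSucc i)) *
      (∑ i : Fin 5, v (Fin.castSucc i) * p (Fin.castSucc i))| ≤ Z₁ * ‖v‖ := by
    rw [abs_mul]
    exact mul_le_mul h1 hv1 (abs_nonneg _) hZ₁
  have hB : |zonal τ (∑ i : Fin 5, z (Fin.castSucc i) * p (Fin.castSucc i))| * |v 5| ≤ Z₀ * ‖v‖ :=
    mul_le_mul h0 hv2 (abs_nonneg _) hZ₀
  calc |deriv (zonal τ) (∑ i : Fin 5, z (Fin.castSucc i) * p (Fin.castSucc i)) *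
          (∑ i : Fin 5, v (Fin.castSucc i) * p (Fin.castSucc i)) -
        zonal τ (∑ i : Fin 5, z (Fin.castSucc i) * p (Fin.castSucc i)) *
          ((z 5 - p 5) / (2 * τ)) * v 5| * Real.exp (-((z 5 - p 5) ^ 2) / (4 * τ))
      ≤ (|deriv (zonal τ) (∑ i : Fin 5, z (Fin.castSucc i) * p (Fin.castSucc i)) *
            (∑ i : Fin 5, v (Fin.castSucc i) * p (Fin.castSucc i))| +
          |zonal τ (∑ i : Fin 5, z (Fin.castSucc i) * p (Fin.castSucc i)) *
            ((z 5 - p 5) / (2 * τ)) * v 5|) * Real.exp (-((z 5 - p 5) ^ 2) / (4 * τ)) :=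
        mul_le_mul_of_nonneg_right (abs_sub _ _) hG0.le
    _ = |deriv (zonal τ) (∑ i : Fin 5, z (Fin.castSucc i) * p (Fin.castSucc i)) *
            (∑ i : Fin 5, v (Fin.castSucc i) * p (Fin.castSucc i))| *
          Real.exp (-((z 5 - p 5) ^ 2) / (4 * τ)) +
        |zonal τ (∑ i : Fin 5, z (Fin.castSucc i) * p (Fin.castSucc i))| * |v 5| *
          (|(z 5 - p 5) / (2 * τ)| * Real.exp (-((z 5 - p 5) ^ 2) / (4 * τ))) := by
        simp only [abs_mul]; ring
    _ ≤ Z₁ * ‖v‖ * 1 + Z₀ * ‖v‖ * (1 / (4 * τ₀) + 1) :=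
        add_le_add (mul_le_mul hA hG1 hG0.le (by positivity))
          (mul_le_mul hB hq (by positivity) (by positivity))
    _ = (Z₁ + Z₀ * (1 / (4 * τ₀) + 1)) * ‖v‖ := by ring

end CylKernelLipschitz

open CylKernelLipschitz in
/-- **W2-2: the typed kernel is Lipschitz on the solid cylinder, uniformly in the centre `p ∈ N` and
the scale `τ ≥ τ₀`.**  For `τ₀ > 0` there is `L` (namely `Z₁ + Z₀ (1/(4τ₀) + 1)` with the series
majorants `Z₀ = ∑_k e^{-k(k+3)τ₀} 32^k ≥ sup |𝔥|`, `Z₁ = ∑_k e^{-k(k+3)τ₀} 128^k ≥ sup |∂_s 𝔥|` on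
`[τ₀, ∞) × [-1, 1]`) such that `z ↦ K_{p,τ}(z)` is `L`-Lipschitz on `{∑_{i<5} zᵢ² ≤ 1}` whenever
`|p'| = 1` and `τ ≥ τ₀` (mean value inequality on the convex solid cylinder with the uniform bound
`norm_fderiv_cylKernel_le` of the derivative). [folklore] -/
theorem helper_cylKernel_lipschitzOn : ∀ τ₀ : ℝ, 0 < τ₀ → ∃ L : NNReal, ∀ p : EuclideanSpace ℝ (Fin 6), ∑ i : Fin 5, p (Fin.castSucc i) ^ 2 = 1 → ∀ τ : ℝ, τ₀ ≤ τ → LipschitzOnWith L (Literature.Geometry.Riemannian.SphericalCylinderEntropy.cylKernel p τ) {z : EuclideanSpace ℝ (Fin 6) | ∑ i : Fin 5, z (Fin.castSucc i) ^ 2 ≤ 1} := by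
  intro τ₀ hτ₀
  set K : ℝ := (∑' k : ℕ, Real.exp (-((k : ℝ) * ((k : ℝ) + 3)) * τ₀) * 128 ^ k) +
    (∑' k : ℕ, Real.exp (-((k : ℝ) * ((k : ℝ) + 3)) * τ₀) * 32 ^ k) * (1 / (4 * τ₀) + 1) with hKdef
  have hZ₀ : 0 ≤ ∑' k : ℕ, Real.exp (-((k : ℝ) * ((k : ℝ) + 3)) * τ₀) * 32 ^ k :=
    tsum_nonneg fun k => by positivity
  have hZ₁ : 0 ≤ ∑' k : ℕ, Real.exp (-((k : ℝ) * ((k : ℝ) + 3)) * τ₀) * 128 ^ k :=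
    tsum_nonneg fun k => by positivity
  have hK : 0 ≤ K := by rw [hKdef]; positivity
  refine ⟨⟨K, hK⟩, fun p hp τ hτ => ?_⟩
  have hτ' : 0 < τ := hτ₀.trans_le hτ
  refine convex_solidCyl.lipschitzOnWith_of_nnnorm_fderiv_le (𝕜 := ℝ)
    (fun z _ => (hasFDerivAt_cylKernel p hτ' z).differentiableAt) fun z hz => ?_
  rw [← NNReal.coe_le_coe, coe_nnnorm]
  exact norm_fderiv_cylKernel_le hτ₀ hτ hp hz

end Summit.SmoothPoincare4.SmoothPoincare4.Theorems.CylinderRungTwo.KillingFlux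

end
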